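import Mathlib
import HarnessLib
import Summits.NavierStokesRegularity.NavierStokesRegularity.Theorems.UnthreadedDoorAntidynamoWallEvenSectorFarPast

/-!
# Route `UnthreadedDoor` / `ThreadingFlux`, crux `PoloidalLiouville` (stmt-NavierStokesRegularity-1222), antidynamo v2 skeleton
# (sha16 `4ebf5683127b`): Z WITH A FAR-PAST HYPOTHESIS, AND THE CENTRE OF A NON-TRIVIAL UNTHREADED FLOW IS UNIQUE

Support file (seat leafhand-ns-unthreadeddoor-2 g0, cell decomp-ns), `--supports stmt-NavierStokesRegularity-1222 --as helper`; theorems only.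

* ★ `curl_eq_zero_of_orthogonal_direction_farPast` — the cell-flux theorem Z (`CellFlux.zonalUnthreadedVorticityVanishes`: unthreaded about
  `x₀` + at EVERY `t < 0` a non-zero direction orthogonal to the vorticity ⇒ irrotational; KNSS Thm 5.2 in a moving frame, PROVED) with the
  direction hypothesis weakened to a FAR PAST `(−∞, t₁)`, `t₁ ≤ 0`: time-shift covariance of the class (`timeShift_class`, p814783) and forward
  vanishing of the vorticity in the class (`CellFlux.forwardVanishing`) do the rest.  This is the form every sector theorem of
  `…WallEvenSectorFarPast` / `…WallSymmetricSector` consumes.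
* ★★ `curl_eq_zero_of_two_centres_farPast` — **THE CENTRE IS UNIQUE**: a bounded ancient mild solution (duality class, measurable slices, jointly
  smooth) that is unthreaded about `x₀` at all times and ALSO unthreaded about a second centre `x₁ ≠ x₀` at every time of a far past is
  irrotational (`⟪x₁ − x₀, ω⟫ = ⟪x − x₀, ω⟫ − ⟪x − x₁, ω⟫ = 0` is a constant orthogonal direction); `constant_of_two_centres_farPast`, and the wall's
  letter `stubScalarLiouville_of_two_centres_farPast`.

MEANING FOR THE WALL `stub_scalarLiouville`: a non-trivial flow of the wall's class has exactly one centre at all sufficiently early times; any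
line that produces a second (even momentary, but persistent into the past) centre of tangency closes the wall.  HONEST LABEL: elementary
corollaries of Z; nothing here proves `stub_scalarLiouville`, `PoloidalLiouville` (1222), or bears on Navier–Stokes regularity; no summit
statement is proved (crux 1222 is INCOMPARABLE with the summit). [folklore]
[cite: KochNadirashviliSereginSverak2009, Thm 5.2 (arXiv:0709.3599 pp. 9–10)]
-/

noncomputable section

-- the summit and its single sub-problem share the name (CONVENTIONS §1)
set_option linter.dupNamespace false

open scoped Topology InnerProductSpace RealInnerProductSpace ContDiff
open Filter Set Function Metric MeasureTheory
open Literature.Analysis.FluidPDE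

namespace Summit.NavierStokesRegularity.NavierStokesRegularity.Theorems.PoloidalLiouville.Antidynamo

open Summit.NavierStokesRegularity.NavierStokesRegularity.Theorems.PoloidalLiouville
  (toroidalPotential exists_norm_curl_le constantOfIrrotational)

/-! ### ★ Z with a far-past direction hypothesis -/

/-- ★ **Z, FAR-PAST FORM.**  Let `v` be a bounded ancient mild solution (`ν = 1`, duality class) with measurable slices, jointly smooth on
`(−∞,0) × ℝ³` and unthreaded about `x₀`.  If for some `t₁ ≤ 0` there is, at every `t < t₁`, a non-zero direction orthogonal to the vorticity,
then `curl v ≡ 0` on `(−∞,0) × ℝ³`. [cite: KochNadirashviliSereginSverak2009, Thm 5.2 (arXiv:0709.3599 pp. 9–10)] -/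
theorem curl_eq_zero_of_orthogonal_direction_farPast
    (v : ℝ → EuclideanSpace ℝ (Fin 3) → EuclideanSpace ℝ (Fin 3)) (x₀ : EuclideanSpace ℝ (Fin 3))
    (hB : Literature.Analysis.FluidPDE.IsBoundedAncientMildSolution 1 v)
    (hm : ∀ t < 0, AEStronglyMeasurable (v t) volume)
    (hsm : ContDiffOn ℝ (⊤ : ℕ∞) (Function.uncurry v) (Set.Iio 0 ×ˢ Set.univ))
    (hun : ∀ t < 0, ∀ x, ⟪x - x₀, curl (v t) x⟫ = 0)
    (hdir : ∃ t₁ ≤ 0, ∀ t < t₁, ∃ e : EuclideanSpace ℝ (Fin 3), e ≠ 0 ∧ ∀ x, ⟪e, curl (v t) x⟫ = 0) :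
    ∀ t < 0, ∀ x, curl (v t) x = 0 := by
  obtain ⟨t₁, ht₁, hdir⟩ := hdir
  obtain ⟨hBw, hmw, hsmw⟩ := timeShift_class hB hm hsm ht₁
  have hunw : ∀ s < 0, ∀ x, ⟪x - x₀, curl ((fun s y => v (s + t₁) y) s) x⟫ = 0 :=
    fun s hs x => hun (s + t₁) (by linarith) x
  obtain ⟨K, hK⟩ := exists_norm_curl_le hBw hsmw
  obtain ⟨T, -, -, hlink⟩ := toroidalPotential (fun s y => v (s + t₁) y) x₀ K hsmw hK hunw
  have hw0 : ∀ s < 0, ∀ x, curl ((fun s y => v (s + t₁) y) s) x = 0 :=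
    CellFlux.zonalUnthreadedVorticityVanishes (fun s y => v (s + t₁) y) x₀ T hBw hmw hsmw hlink fun s hs =>
      hdir (s + t₁) (by linarith)
  have hlt : ∀ t < t₁, ∀ x, curl (v t) x = 0 := fun t ht x => by
    have h := hw0 (t - t₁) (by linarith) x
    simp only [sub_add_cancel] at h
    exact h
  intro t ht x
  by_cases htt : t < t₁
  · exact hlt t htt x
  · have htt' : t₁ ≤ t := not_lt.mp htt
    exact CellFlux.forwardVanishing v hB hm hsm (t₁ - 1) (by linarith) (hlt (t₁ - 1) (by linarith)) t (by linarith) ht x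

/-! ### ★★ The centre is unique -/

/-- ★★ **TWO CENTRES ⇒ IRROTATIONAL.**  A bounded ancient mild solution (duality class, measurable slices, jointly smooth) unthreaded about `x₀`
at every `t < 0` and about a second centre `x₁ ≠ x₀` at every time of a far past `(−∞, t₁)`, `t₁ ≤ 0`, has `curl v ≡ 0` on `(−∞,0) × ℝ³`:
`x₁ − x₀` is a constant direction orthogonal to the vorticity there. [cite: KochNadirashviliSereginSverak2009, Thm 5.2 (arXiv:0709.3599 pp. 9–10)] -/
theorem curl_eq_zero_of_two_centres_farPast
    (v : ℝ → EuclideanSpace ℝ (Fin 3) → EuclideanSpace ℝ (Fin 3)) (x₀ x₁ : EuclideanSpace ℝ (Fin 3)) (hx : x₁ ≠ x₀)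
    (hB : Literature.Analysis.FluidPDE.IsBoundedAncientMildSolution 1 v)
    (hm : ∀ t < 0, AEStronglyMeasurable (v t) volume)
    (hsm : ContDiffOn ℝ (⊤ : ℕ∞) (Function.uncurry v) (Set.Iio 0 ×ˢ Set.univ))
    (hun : ∀ t < 0, ∀ x, ⟪x - x₀, curl (v t) x⟫ = 0)
    (hun₁ : ∃ t₁ ≤ 0, ∀ t < t₁, ∀ x, ⟪x - x₁, curl (v t) x⟫ = 0) :
    ∀ t < 0, ∀ x, curl (v t) x = 0 := by
  obtain ⟨t₁, ht₁, hun₁⟩ := hun₁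
  refine curl_eq_zero_of_orthogonal_direction_farPast v x₀ hB hm hsm hun
    ⟨t₁, ht₁, fun t ht => ⟨x₁ - x₀, sub_ne_zero.2 hx, fun x => ?_⟩⟩
  have h0 := hun t (by linarith) x
  have h1 := hun₁ t ht x
  have e : x₁ - x₀ = (x - x₀) - (x - x₁) := by abel
  rw [e, inner_sub_left, h0, h1, sub_zero]

/-- ★★ **… HENCE SLICE-WISE CONSTANT** (`constantOfIrrotational`). [cite: KochNadirashviliSereginSverak2009, Thm 5.2 (arXiv:0709.3599 pp. 9–10)] -/
theorem constant_of_two_centres_farPast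
    (v : ℝ → EuclideanSpace ℝ (Fin 3) → EuclideanSpace ℝ (Fin 3)) (x₀ x₁ : EuclideanSpace ℝ (Fin 3)) (hx : x₁ ≠ x₀)
    (hB : Literature.Analysis.FluidPDE.IsBoundedAncientMildSolution 1 v)
    (hm : ∀ t < 0, AEStronglyMeasurable (v t) volume)
    (hsm : ContDiffOn ℝ (⊤ : ℕ∞) (Function.uncurry v) (Set.Iio 0 ×ˢ Set.univ))
    (hun : ∀ t < 0, ∀ x, ⟪x - x₀, curl (v t) x⟫ = 0)
    (hun₁ : ∃ t₁ ≤ 0, ∀ t < t₁, ∀ x, ⟪x - x₁, curl (v t) x⟫ = 0) :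
    ∀ t < 0, ∃ b : EuclideanSpace ℝ (Fin 3), ∀ x, v t x = b :=
  constantOfIrrotational v hB hsm (curl_eq_zero_of_two_centres_farPast v x₀ x₁ hx hB hm hsm hun hun₁)

/-- ★★ **THE WALL'S LETTER: A SECOND CENTRE IN A FAR PAST CLOSES IT.**  If the vorticity of the wall's flow is `∇T(t, ·) × (· − x₀)` and is also
tangent to the spheres about some `x₁ ≠ x₀` at every `t < t₁` (`t₁ ≤ 0`), then `∇T × (x − x₀) ≡ 0` on `(−∞,0) × ℝ³`.
[cite: KochNadirashviliSereginSverak2009, Thm 5.2 (arXiv:0709.3599 pp. 9–10)] -/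
theorem stubScalarLiouville_of_two_centres_farPast
    (v : ℝ → EuclideanSpace ℝ (Fin 3) → EuclideanSpace ℝ (Fin 3)) (x₀ x₁ : EuclideanSpace ℝ (Fin 3)) (hx : x₁ ≠ x₀)
    (T : ℝ → EuclideanSpace ℝ (Fin 3) → ℝ)
    (hB : Literature.Analysis.FluidPDE.IsBoundedAncientMildSolution 1 v)
    (hm : ∀ t < 0, AEStronglyMeasurable (v t) volume)
    (hsm : ContDiffOn ℝ (⊤ : ℕ∞) (Function.uncurry v) (Set.Iio 0 ×ˢ Set.univ))
    (hrep : ∀ t < 0, ∀ x, Literature.Analysis.FluidPDE.curl (v t) x =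
      Literature.Analysis.FluidPDE.cross (gradient (T t) x) (x - x₀))
    (hun₁ : ∃ t₁ ≤ 0, ∀ t < t₁, ∀ x,
      ⟪x - x₁, Literature.Analysis.FluidPDE.cross (gradient (T t) x) (x - x₀)⟫ = 0) :
    ∀ t < 0, ∀ x, Literature.Analysis.FluidPDE.cross (gradient (T t) x) (x - x₀) = 0 := by
  -- a toroidal field is tangent to the spheres about its centre: `⟪y, a × y⟫ = 0`
  have hun : ∀ t < 0, ∀ x, ⟪x - x₀, curl (v t) x⟫ = 0 := fun t ht x => by
    rw [hrep t ht x]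
    simp [cross, crossProduct, PiLp.inner_apply, Fin.sum_univ_three]
    ring
  obtain ⟨t₁, ht₁, hun₁⟩ := hun₁
  have hun₁' : ∃ t₁ ≤ 0, ∀ t < t₁, ∀ x, ⟪x - x₁, curl (v t) x⟫ = 0 :=
    ⟨t₁, ht₁, fun t ht x => by rw [hrep t (by linarith) x]; exact hun₁ t ht x⟩
  intro t ht x
  rw [← hrep t ht x]
  exact curl_eq_zero_of_two_centres_farPast v x₀ x₁ hx hB hm hsm hun hun₁' t ht x

end Summit.NavierStokesRegularity.NavierStokesRegularity.Theorems.PoloidalLiouville.Antidynamo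

end
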